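import Summits.CriticalPhenomena.CardyFormulaZ2.Theorems.CardySusyWardParafermionFamiliesToSLESixTouchLowerBound
import Literature.Probability.RandomPlanarGeometry.PlanarDomainsTopology
import Literature.Probability.Percolation.QuadCrossingPathCrossings
import Mathlib.Topology.Baire.Lemmas
import Mathlib.Topology.Baire.CompleteMetrizable

/-!
# Touch lower bound on diagonal free walls (stub `stub_touchLowerBound`, reshape r2, of the line
# `exact-potential-schwarz-christoffel`, crux stmt-CriticalPhenomena-10814), F: a flat piece of the free arc in a window

Helper file (plane topology, part 1 of the extraction of the one-sided box from the stub's hypotheses). For a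
DIAGONAL-rectilinear Dobrushin domain `P` (frontier inside finitely many segments of slope `±1`) and an open window `W`
meeting the free arc `P.arc 1` with `closure W` off the wired arc `P.arc 0`, `exists_flat_piece` produces a straight
diagonal piece of `∂P` inside `W`: a sign `b = ±1`, a level `c` and columns `T₁ < T₂` such that every point `z` of the
line `{x + b y = c}` with column `x - b y ∈ [T₁, T₂]` lies in `W ∩ ∂P`. Proof: the point of `W ∩ P.arc 1` has an
interior parameter (it is off `P.arc 0 ∋` both marks); a closed parameter interval around it is mapped into `W`; it is
covered by the finitely many closed preimages of the sides, so (Baire) one of them contains a non-trivial parameter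
interval `[u₁, u₂]`; the image of `[u₁, u₂]` is a connected subset of that side with two distinct points (injectivity
of the boundary loop on a period), hence contains the sub-segment between them (intermediate values of the affine
parameter), which is the announced piece.
-/

noncomputable section

namespace Summit.CriticalPhenomena.CardyFormulaZ2.Theorems.ParafermionFamiliesToSLESix.TouchLowerBound

open Set Metric Complex Filter
open scoped Topology
open Literature.Probability.RandomPlanarGeometry
open Literature.Probability.Percolation (isCompact_segment_complex)

/-- **An interior parameter of the free arc.** A point of `P.arc 1` off `P.arc 0` is `P.boundary t` for a parameter
`t` strictly between `mark 1` and `nextMark 1`. [folklore] -/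
theorem exists_mem_Ioo_of_mem_arc_one (P : DobrushinDomain) {p : ℂ} (hp1 : p ∈ P.arc 1) (hp0 : p ∉ P.arc 0) :
    ∃ t ∈ Ioo (P.mark 1) (P.nextMark 1), P.boundary t = p := by
  obtain ⟨t, ht, rfl⟩ := hp1
  refine ⟨t, ⟨lt_of_le_of_ne ht.1 ?_, lt_of_le_of_ne ht.2 ?_⟩, rfl⟩
  · rintro h
    apply hp0
    rw [← h]
    have h1 : P.pt ((0 : Fin 2) + 1) ∈ P.arc 0 := P.pt_succ_mem_arc 0
    rwa [show (0 : Fin 2) + 1 = 1 from rfl] at h1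
  · intro h
    apply hp0
    rw [h, P.boundary_nextMark, show (1 : Fin 2) + 1 = 0 from rfl]
    exact P.pt_mem_arc_self 0

/-- Interior parameters of `arc 1` lie in the shifted period `[mark 0, mark 0 + 1)`. [folklore] -/
theorem mem_Ico_of_mem_Ioo (P : DobrushinDomain) {u : ℝ} (hu : u ∈ Ioo (P.mark 1) (P.nextMark 1)) :
    u ∈ Ico (P.mark 0) (P.mark 0 + 1) :=
  ⟨(P.mark_zero_le 1).trans hu.1.le, hu.2.trans_le (P.nextMark_le_mark_zero_add_one 1)⟩

/-- On a segment, the real affine parameter `Re((z - z₁)/(z₂ - z₁))` inverts `θ ↦ z₁ + θ (z₂ - z₁)`. [folklore] -/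
theorem lineMap_param_of_mem_segment {z₁ z₂ z : ℂ} (hz : z₁ ≠ z₂) (h : z ∈ segment ℝ z₁ z₂) :
    z₁ + ((((z - z₁) / (z₂ - z₁)).re : ℝ) : ℂ) * (z₂ - z₁) = z := by
  have hd : z₂ - z₁ ≠ 0 := sub_ne_zero.2 (Ne.symm hz)
  rw [segment_eq_image'] at h
  obtain ⟨t, -, rfl⟩ := h
  have : (((z₁ + t • (z₂ - z₁) - z₁) / (z₂ - z₁)).re : ℝ) = t := by
    rw [add_sub_cancel_left, Complex.real_smul, mul_div_assoc, div_self hd, mul_one, Complex.ofReal_re]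
  show z₁ + ((((z₁ + t • (z₂ - z₁) - z₁) / (z₂ - z₁)).re : ℝ) : ℂ) * (z₂ - z₁) = z₁ + t • (z₂ - z₁)
  rw [this, Complex.real_smul]

/-- **A connected subset of a segment containing two of its points contains the sub-segment between them**, in the
form: if `C ⊆ [z₁, z₂]` is the continuous image of an interval and contains `γ v₁`, `γ v₂`, then it contains
`z₁ + θ (z₂ - z₁)` for every `θ` between their affine parameters. [folklore] -/
theorem lineMap_mem_of_image {z₁ z₂ : ℂ} (hz : z₁ ≠ z₂) {γ : ℝ → ℂ} (hγ : Continuous γ) {u₁ u₂ : ℝ}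
    (hC : γ '' Icc u₁ u₂ ⊆ segment ℝ z₁ z₂) {v₁ v₂ : ℝ} (hv₁ : v₁ ∈ Icc u₁ u₂) (hv₂ : v₂ ∈ Icc u₁ u₂) {θ : ℝ}
    (hθ : θ ∈ uIcc ((γ v₁ - z₁) / (z₂ - z₁)).re ((γ v₂ - z₁) / (z₂ - z₁)).re) :
    z₁ + (θ : ℂ) * (z₂ - z₁) ∈ γ '' Icc u₁ u₂ := by
  set ψ : ℂ → ℝ := fun z => ((z - z₁) / (z₂ - z₁)).re with hψ
  have hψc : Continuous ψ := by
    simp only [hψ]; fun_prop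
  have hΛ : IsPreconnected ((ψ ∘ γ) '' Icc u₁ u₂) := isPreconnected_Icc.image _ (hψc.comp hγ).continuousOn
  have hmem : ∀ v ∈ Icc u₁ u₂, ψ (γ v) ∈ (ψ ∘ γ) '' Icc u₁ u₂ := fun v hv => ⟨v, hv, rfl⟩
  have hsub : uIcc (ψ (γ v₁)) (ψ (γ v₂)) ⊆ (ψ ∘ γ) '' Icc u₁ u₂ := by
    rcases le_total (ψ (γ v₁)) (ψ (γ v₂)) with h | h
    · rw [uIcc_of_le h]; exact hΛ.Icc_subset (hmem v₁ hv₁) (hmem v₂ hv₂)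
    · rw [uIcc_of_ge h]; exact hΛ.Icc_subset (hmem v₂ hv₂) (hmem v₁ hv₁)
  obtain ⟨v, hv, hvθ⟩ := hsub hθ
  refine ⟨v, hv, ?_⟩
  have := lineMap_param_of_mem_segment hz (hC ⟨v, hv, rfl⟩)
  simp only [Function.comp_apply, hψ] at hvθ
  rw [← this, hvθ]

/-- Scaling an unordered interval: `k x ∈ [k a, k b]` and `k ≠ 0` give `x ∈ [a, b]` (unordered). [folklore] -/
theorem mem_uIcc_of_mul_mem_uIcc {k x a₁ a₂ : ℝ} (hk : k ≠ 0) (h : k * x ∈ uIcc (k * a₁) (k * a₂)) :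
    x ∈ uIcc a₁ a₂ := by
  rw [mem_uIcc] at h ⊢
  rcases lt_or_gt_of_ne hk with hk | hk
  · rcases h with ⟨h1, h2⟩ | ⟨h1, h2⟩
    · right; constructor <;> nlinarith
    · left; constructor <;> nlinarith
  · rcases h with ⟨h1, h2⟩ | ⟨h1, h2⟩
    · left; constructor <;> nlinarith
    · right; constructor <;> nlinarith

/-- **A flat diagonal piece of the free arc inside the window.** See the module docstring. [folklore] -/
theorem exists_flat_piece (P : DobrushinDomain)
    (hdiag : ∃ S : Finset (ℂ × ℂ), (∀ p ∈ S, (p.1 - p.2).re = (p.1 - p.2).im ∨ (p.1 - p.2).re = -(p.1 - p.2).im) ∧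
      frontier P.carrier ⊆ ⋃ p ∈ S, segment ℝ p.1 p.2)
    {W : Set ℂ} (hWo : IsOpen W) (hW : Disjoint (closure W) (P.arc 0)) (hne : (W ∩ P.arc 1).Nonempty) :
    ∃ (b : ℤ) (c T₁ T₂ : ℝ), (b = 1 ∨ b = -1) ∧ T₁ < T₂ ∧
      ∀ z : ℂ, z.re + b * z.im = c → T₁ ≤ z.re - b * z.im → z.re - b * z.im ≤ T₂ → z ∈ W ∧ z ∈ frontier P.carrier := by
  classical
  obtain ⟨S, hS, hfront⟩ := hdiag
  obtain ⟨p, hpW, hp1⟩ := hne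
  -- Step 1: an interior parameter
  have hp0 : p ∉ P.arc 0 := fun h => (Set.disjoint_left.1 hW) (subset_closure hpW) h
  obtain ⟨t, ht, rfl⟩ := exists_mem_Ioo_of_mem_arc_one P hp1 hp0
  -- Step 2: a closed parameter interval around `t` mapped into `W`
  obtain ⟨r, hr, hball⟩ := Metric.isOpen_iff.1 hWo _ hpW
  obtain ⟨η, hη, hηr⟩ := Metric.continuous_iff.1 P.continuous_boundary t r hr
  set ε : ℝ := min (η / 2) (min ((t - P.mark 1) / 2) ((P.nextMark 1 - t) / 2)) with hε_def
  have hε : 0 < ε := by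
    have := ht.1; have := ht.2
    positivity
  have hε₁ : ε ≤ η / 2 := min_le_left _ _
  have hε₂ : ε ≤ (t - P.mark 1) / 2 := (min_le_right _ _).trans (min_le_left _ _)
  have hε₃ : ε ≤ (P.nextMark 1 - t) / 2 := (min_le_right _ _).trans (min_le_right _ _)
  have hI : ∀ u ∈ Icc (t - ε) (t + ε), u ∈ Ioo (P.mark 1) (P.nextMark 1) ∧ P.boundary u ∈ W := by
    intro u hu
    refine ⟨⟨by linarith [hu.1], by linarith [hu.2]⟩, hball ?_⟩
    rw [Metric.mem_ball]
    refine hηr u ?_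
    rw [Real.dist_eq, abs_lt]
    constructor <;> linarith [hu.1, hu.2]
  -- Step 3: Baire on the parameter interval
  set I : Set ℝ := Icc (t - ε) (t + ε) with hI_def
  haveI : CompleteSpace I := isClosed_Icc.isComplete.completeSpace_coe
  haveI : Nonempty I := ⟨⟨t, by constructor <;> linarith⟩⟩
  have hcover : ⋃ s : S, {u : I | P.boundary u ∈ segment ℝ s.1.1 s.1.2} = univ := by
    ext u
    simp only [mem_iUnion, mem_setOf_eq, mem_univ, iff_true]
    have hu : P.boundary u ∈ frontier P.carrier := P.boundary_mem_frontier u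
    have := hfront hu
    rw [mem_iUnion₂] at this
    obtain ⟨s, hs, hmem⟩ := this
    exact ⟨⟨s, hs⟩, hmem⟩
  have hclosed : ∀ s : S, IsClosed {u : I | P.boundary u ∈ segment ℝ s.1.1 s.1.2} := fun s =>
    (isCompact_segment_complex _ _).isClosed.preimage (P.continuous_boundary.comp continuous_subtype_val)
  obtain ⟨s, u₀, hu₀⟩ := nonempty_interior_of_iUnion_of_closed hclosed hcover
  rw [mem_interior_iff_mem_nhds, Metric.mem_nhds_iff] at hu₀
  obtain ⟨θ, hθ, hθsub⟩ := hu₀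
  have hu₀I : (u₀ : ℝ) ∈ I := u₀.2
  set u₁ : ℝ := max (t - ε) (u₀ - θ / 2) with hu₁
  set u₂ : ℝ := min (t + ε) (u₀ + θ / 2) with hu₂
  have hl₀ : t - ε ≤ u₀ := hu₀I.1
  have hr₀ : (u₀ : ℝ) ≤ t + ε := hu₀I.2
  have hu12 : u₁ < u₂ := by
    simp only [hu₁, hu₂, max_lt_iff, lt_min_iff]
    refine ⟨⟨?_, ?_⟩, ?_, ?_⟩ <;> linarith
  have hsub12 : Icc u₁ u₂ ⊆ I := fun u hu =>
    ⟨(le_max_left _ _).trans hu.1, hu.2.trans (min_le_left _ _)⟩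
  have hseg : P.boundary '' Icc u₁ u₂ ⊆ segment ℝ s.1.1 s.1.2 := by
    rintro _ ⟨u, hu, rfl⟩
    have huI : u ∈ I := hsub12 hu
    have hl : u₀ - θ / 2 ≤ u := (le_max_right _ _ : u₀ - θ / 2 ≤ u₁).trans hu.1
    have hr' : u ≤ u₀ + θ / 2 := hu.2.trans (min_le_right _ _ : u₂ ≤ u₀ + θ / 2)
    have hball' : (⟨u, huI⟩ : I) ∈ Metric.ball u₀ θ := by
      rw [Metric.mem_ball, Subtype.dist_eq, Real.dist_eq, abs_lt]
      constructor <;> linarith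
    exact hθsub hball'
  -- Step 4: two distinct points of the side
  set z₁ : ℂ := s.1.1 with hz₁
  set z₂ : ℂ := s.1.2 with hz₂
  have hmem₁ : u₁ ∈ Icc u₁ u₂ := left_mem_Icc.2 hu12.le
  have hmem₂ : u₂ ∈ Icc u₁ u₂ := right_mem_Icc.2 hu12.le
  have hinj : P.boundary u₁ ≠ P.boundary u₂ := by
    intro h
    have h1 := (hI u₁ (hsub12 hmem₁)).1
    have h2 := (hI u₂ (hsub12 hmem₂)).1
    have := P.injOn_boundary_Ico_mark_zero (mem_Ico_of_mem_Ioo P h1) (mem_Ico_of_mem_Ioo P h2) h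
    exact hu12.ne this
  have hq₁ : P.boundary u₁ ∈ segment ℝ z₁ z₂ := hseg ⟨u₁, hmem₁, rfl⟩
  have hq₂ : P.boundary u₂ ∈ segment ℝ z₁ z₂ := hseg ⟨u₂, hmem₂, rfl⟩
  have hz : z₁ ≠ z₂ := by
    intro h
    apply hinj
    rw [h, segment_same, mem_singleton_iff] at hq₁ hq₂
    rw [hq₁, hq₂]
  set d : ℂ := z₂ - z₁ with hd_def
  have hd0 : d ≠ 0 := sub_ne_zero.2 (Ne.symm hz)
  -- the slope: `d.im = -b d.re` with `b = ±1`, and `d.re ≠ 0`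
  obtain ⟨b, hb, hbd⟩ : ∃ b : ℤ, (b = 1 ∨ b = -1) ∧ d.im = -(b : ℝ) * d.re := by
    have e : (s.1.1 - s.1.2) = -d := by rw [hd_def]
                                        ring
    rcases hS s.1 s.2 with h | h
    · refine ⟨-1, Or.inr rfl, ?_⟩
      rw [e, neg_re, neg_im] at h
      push_cast; linarith
    · refine ⟨1, Or.inl rfl, ?_⟩
      rw [e, neg_re, neg_im] at h
      push_cast; linarith
  have hb2 : (b : ℝ) * b = 1 := by rcases hb with rfl | rfl <;> norm_num
  have hdre : d.re ≠ 0 := by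
    intro h0
    apply hd0
    apply Complex.ext
    · simpa using h0
    · rw [hbd, h0]; simp
  -- level and column along the line
  have hlevel : ∀ θ : ℝ, (z₁ + (θ : ℂ) * d).re + b * (z₁ + (θ : ℂ) * d).im = z₁.re + b * z₁.im := by
    intro θ
    simp only [add_re, mul_re, ofReal_re, ofReal_im, zero_mul, sub_zero, add_im, mul_im, add_zero]
    rw [hbd]; linear_combination (-(θ * d.re)) * hb2
  have hcol : ∀ θ : ℝ, (z₁ + (θ : ℂ) * d).re - b * (z₁ + (θ : ℂ) * d).im = (z₁.re - b * z₁.im) + 2 * θ * d.re := by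
    intro θ
    simp only [add_re, mul_re, ofReal_re, ofReal_im, zero_mul, sub_zero, add_im, mul_im, add_zero]
    rw [hbd]; linear_combination (θ * d.re) * hb2
  -- the affine parameters and columns of the two points
  set θ₁ : ℝ := ((P.boundary u₁ - z₁) / (z₂ - z₁)).re with hθ₁
  set θ₂ : ℝ := ((P.boundary u₂ - z₁) / (z₂ - z₁)).re with hθ₂
  have e₁ : z₁ + (θ₁ : ℂ) * d = P.boundary u₁ := lineMap_param_of_mem_segment hz hq₁
  have e₂ : z₁ + (θ₂ : ℂ) * d = P.boundary u₂ := lineMap_param_of_mem_segment hz hq₂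
  have hθ12 : θ₁ ≠ θ₂ := fun h => hinj (by rw [← e₁, ← e₂, h])
  set c : ℝ := z₁.re + b * z₁.im with hc
  set τ₀ : ℝ := z₁.re - b * z₁.im with hτ₀
  have hT12 : τ₀ + 2 * θ₁ * d.re ≠ τ₀ + 2 * θ₂ * d.re := by
    intro h
    apply hθ12
    have : (θ₁ - θ₂) * d.re = 0 := by linarith
    rcases mul_eq_zero.1 this with h' | h'
    · linarith
    · exact absurd h' hdre
  -- Step 5: output
  refine ⟨b, c, min (τ₀ + 2 * θ₁ * d.re) (τ₀ + 2 * θ₂ * d.re), max (τ₀ + 2 * θ₁ * d.re) (τ₀ + 2 * θ₂ * d.re), hb,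
    min_lt_max.2 hT12, fun z hzc hT₁ hT₂ => ?_⟩
  -- the affine parameter of `z`
  set θz : ℝ := (z.re - b * z.im - τ₀) / (2 * d.re) with hθz
  have h2θ : 2 * θz * d.re = z.re - b * z.im - τ₀ := by rw [hθz]; field_simp
  have hzeq : z = z₁ + (θz : ℂ) * d := by
    have l1 := hlevel θz
    have l2 := hcol θz
    rw [hc] at hzc
    apply Complex.ext
    · show z.re = (z₁ + (θz : ℂ) * d).re
      linarith
    · show z.im = (z₁ + (θz : ℂ) * d).im
      have e3 : (b : ℝ) * z.im = b * (z₁ + (θz : ℂ) * d).im := by linarith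
      rcases hb with rfl | rfl <;> push_cast at e3 <;> linarith
  -- it lies between `θ₁` and `θ₂`
  have hθmem : θz ∈ uIcc θ₁ θ₂ := by
    refine mem_uIcc_of_mul_mem_uIcc (k := 2 * d.re) (by positivity) ?_
    have hmem : z.re - b * z.im ∈ uIcc (τ₀ + 2 * θ₁ * d.re) (τ₀ + 2 * θ₂ * d.re) := ⟨hT₁, hT₂⟩
    rw [mem_uIcc] at hmem ⊢
    rcases hmem with ⟨h1, h2⟩ | ⟨h1, h2⟩
    · left; constructor <;> nlinarith
    · right; constructor <;> nlinarith
  -- so `z` is a boundary point with parameter in `[u₁, u₂]`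
  obtain ⟨u, hu, huz⟩ := lineMap_mem_of_image hz P.continuous_boundary hseg hmem₁ hmem₂ hθmem
  rw [← hd_def, ← hzeq] at huz
  rw [← huz]
  exact ⟨(hI u (hsub12 hu)).2, P.boundary_mem_frontier u⟩

/-- **Registered one-line ticket `stub_touch_wallF`** (helper F of `stub_touchLowerBound`): a point of the free arc off
the wired arc has an interior parameter. [folklore] -/
theorem stub_touch_wallF : ∀ (P : DobrushinDomain) (p : ℂ), p ∈ P.arc 1 → p ∉ P.arc 0 → ∃ t ∈ Set.Ioo (P.mark 1) (P.nextMark 1), P.boundary t = p :=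
  fun P _ hp1 hp0 => exists_mem_Ioo_of_mem_arc_one P hp1 hp0

end Summit.CriticalPhenomena.CardyFormulaZ2.Theorems.ParafermionFamiliesToSLESix.TouchLowerBound

end
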